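import Mathlib.RingTheory.MvPolynomial.Basic
import Mathlib.Algebra.MvPolynomial.PDeriv
import Mathlib.Algebra.MvPolynomial.Monad
import Mathlib.Analysis.Complex.Basic
import Mathlib.LinearAlgebra.Matrix.DotProduct
import Mathlib.LinearAlgebra.Matrix.Symmetric
import Mathlib.Algebra.QuadraticDiscriminant
import Mathlib.Topology.Algebra.Polynomial
import HarnessLib

/-!
# Stable polynomials (upper half-plane), the multi-affine bridge, and the symbol / Rayleigh criteria

Topic `Literature/Combinatorics/StablePolynomials`. Vocabulary requested by route
`AtomisticToContinuum/BoseEinsteinCondensation/BECPolyaSchur` (items `GroundStateStability`,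
`stmt-AtomisticToContinuum-8727`, and `StableImpliesPairCoherence`, `stmt-…-8729`, which write the
half-plane condition inline as "`Σ_S φ(S) ∏_{x∈S} z_x ≠ 0` whenever all `Im z_x > 0`").
Sources: J. Borcea, P. Brändén, *The Lee–Yang and Pólya–Schur programs I*, Invent. Math. 177
(2009) (arXiv:0809.0401), Introduction, §1 (Thm. 1.1, Lemmas 1.5, 1.7), §2.1 (multi-affine
polynomials, Lemma 2.2); P. Brändén, *Polynomials with the half-plane property and matroid theory*,
Adv. Math. 216 (2007) (arXiv:math/0605678), §3, Thm. 5.6; P. Brändén, J. Huh, *Lorentzian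
polynomials* (arXiv:1902.03719), §1, Prop. 1.2, Lemma 1.5.

## Contents (namespace `Literature.Combinatorics.StablePolynomials`)

Definitions (all with bodies):
* `IsUpperHalfPlaneStable p` (`p : MvPolynomial σ ℂ`): `p(z) ≠ 0` for all `z` with every
  `Im zᵢ > 0` — Borcea–Brändén's "stable" (= `H`-stable; the zero polynomial is not stable);
* `IsRealStable p` (`p : MvPolynomial σ ℝ`): the complexification is stable ("real stable");
* `multiAffine a = Σ_S a(S) z^S` (coefficient form of a multi-affine polynomial, `a : Finset σ → R`)
  with `eval_multiAffine`, `map_multiAffine` and **the bridge**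
  `isUpperHalfPlaneStable_multiAffine_iff` / `isRealStable_multiAffine_iff` (stability of
  `multiAffine a` ↔ the route's inline condition, syntactically);
* `IsMultiAffine p` (degree `≤ 1` in each variable; `isMultiAffine_iff_support`);
* `multiAffineSymbol T = Σ_S T[z^S] w^{[n]∖S}` (Borcea–Brändén's `G_T(z,w) = T[(z+w)^κ]`,
  `κ = (1,…,1)`, variables `σ ⊕ σ`); `rayleighDiff i j f = ∂ᵢf ∂ⱼf - ∂ᵢ∂ⱼf · f` (Brändén's `Δᵢⱼ`).

Proved API:
* `isUpperHalfPlaneStable_C/_X/_mul_iff/_prod/_prod_X`, `IsUpperHalfPlaneStable.ne_zero/.mul`;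
* closure under positive diagonal scaling `zᵢ ↦ cᵢzᵢ` (`IsUpperHalfPlaneStable.diagScale`,
  Borcea–Brändén Lemma 1.7 (2)), specialisation of a variable at a point of the *open* upper
  half-plane (`.specialize`), identification of two variables (`.identify`, Lemma 1.7 (4)) — all via
  `MvPolynomial.bind₁` (`eval_bind₁`);
* the line criteria: `isUpperHalfPlaneStable_iff_line` (Borcea–Brändén Lemma 1.5: stable iff every
  restriction `t ↦ p(a + tb)`, `b ∈ ℝ₊ⁿ`, is zero-free on `Im t > 0`) and, for real polynomials,
  `isRealStable_iff_line` (Brändén 2007, §3: real stable iff all `p(a + tb)` are real-rooted), with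
  `conj_eval₂_algebraMap`;
* `e₁ = Σ zᵢ` and `eₙ = ∏ zᵢ` are stable (`isUpperHalfPlaneStable_sum_X`, `_prod_X_univ`);
* **stable quadratic forms have Lorentzian signature on the nonnegative orthant**
  (`four_mul_quadratic_le_sq_of_pos`, `four_mul_quadratic_le_sq`, `dotProduct_mulVec_sq_ge`): if
  `q(z) = Σ Kᵢⱼ zᵢzⱼ` (real `K`) has no zero in `Hⁿ` then `(uᵀKv)² ≥ (uᵀKu)(vᵀKv)` for `u ≥ 0`
  — the reverse Cauchy–Schwarz inequality of Brändén–Huh, Lemma 1.5, in the closed form in which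
  route item `StableImpliesPairCoherence` uses "stable ⇒ Lorentzian" (their Prop. 1.2); proved here
  from the discriminant of `x ↦ q(xu + v)` and a limit `u + ε𝟙 → u`.

Named facts (hypotheses for the route; `def … : Prop`, not proved here):
* `BorceaBranden2009_multiAffine_stabilityPreserver_iff` — Borcea–Brändén 2009, Thm. 1.1 in the
  multi-affine case `κ = (1,…,1)`: a linear `T` preserves stability on multi-affine polynomials iff
  (a) `T f = α(f) P` with `P` stable, or (b) the symbol `G_T` is stable; with the derived
  sufficiency `stabilityPreserver_of_multiAffineSymbol` (= their Lemma 2.2, what the route uses);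
* `Branden2007_multiAffine_rayleighDiff_nonneg_iff_realStable` — Brändén 2007, Thm. 5.6 (for
  `f ≠ 0`): a real multi-affine `f` is real stable iff all `Δᵢⱼ(f) ≥ 0` on `ℝⁿ`; with
  `isRealStable_of_rayleighDiff_nonneg`.

## Not in this file (follow-ups)

Closure under specialisation at *real* points and under `∂ᵢ`, limits of stable polynomials
("multivariate Hurwitz": Borcea–Brändén Thm. 1.6 / Lemma 1.7 (1)), and stability of all
elementary symmetric polynomials `e_k` need Hurwitz's theorem along complex lines
(`Literature.Analysis.Complex.hurwitz_eqOn_zero_or_forall_ne_zero`) and Gauss–Lucas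
(`Polynomial.rootSet_derivative_subset_convexHull_rootSet`); they are intended for a companion
file importing this one. The Lorentzian vocabulary of Brändén–Huh (Def. 1.1) is not introduced;
only its quadratic consequence above is.

## Design / Mathlib

* Mathlib has `MvPolynomial` with `eval`, `bind₁` (substitution), `pderiv`, `degreeOf`, `rename`,
  the quadratic formula (`quadratic_eq_zero_iff`, `discrim`) and Gauss–Lucas, but no notion of
  stable / half-plane / Lorentzian polynomial (searched `stable`, `halfPlane`, `Lorentzian`,
  `hyperbolic polynomial`).
* Real stability is a predicate on `MvPolynomial σ ℝ` (through `map (algebraMap ℝ ℂ)`), so that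
  Brändén's criterion can be stated with `pderiv` and real evaluation; `isRealStable_iff` and
  `isRealStable_multiAffine_iff` unfold it to complex evaluations.
* The named facts quantify over `σ : Type` with `[Fintype σ]` (and `[Nonempty σ]` for Thm. 1.1,
  "`n` an arbitrary positive integer"); `T` is taken on all of `MvPolynomial σ ℂ` and constrained
  only on multi-affine inputs (any linear map on `ℂ_κ[z]` extends linearly), which is equivalent to
  the printed formulation on `ℂ_κ[z₁,…,zₙ]`.

## References

* J. Borcea, P. Brändén, *The Lee–Yang and Pólya–Schur programs. I. Linear operators preserving
  stability*, Invent. Math. 177 (2009) 541–569 (arXiv:0809.0401): Introduction (Ω-stable,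
  stability preservers), §1 (stable, real stable; Thm. 1.1; Lemma 1.5; Lemma 1.7), §2.1
  (multi-affine polynomials; Lemma 2.2). [BorceaBranden2009]
* P. Brändén, *Polynomials with the half-plane property and matroid theory*, Adv. Math. 216 (2007)
  302–320 (arXiv:math/0605678): §1, §3 (real stable; line criterion), §5, Thm. 5.6. [Branden2007]
* P. Brändén, J. Huh, *Lorentzian polynomials*, arXiv:1902.03719 (Ann. of Math. 192 (2020)): §1,
  Def. 1.1, Prop. 1.2, Lemma 1.5 (arXiv numbering). [BrandenHuh2019]
* J. Borcea, P. Brändén, T. M. Liggett, *Negative dependence and the geometry of polynomials*,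
  J. Amer. Math. Soc. 22 (2009) (arXiv:0707.2340) (background: strongly Rayleigh measures).
  [BorceaBrandenLiggett2007]
-/

noncomputable section

open MvPolynomial Finset
open scoped BigOperators ComplexConjugate Matrix

namespace Literature.Combinatorics.StablePolynomials

variable {σ : Type*}

/-! ### Stability with respect to the open upper half-plane -/

/-- **Stable polynomial** (Borcea–Brändén 2009, Introduction: for `Ω ⊆ ℂⁿ`, "`f ∈ ℂ[z₁,…,zₙ]` is
`Ω`-stable if `f(z₁,…,zₙ) ≠ 0` whenever `(z₁,…,zₙ) ∈ Ω`", and, §1, with `H = {z : Im z > 0}`: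
"`H`-stable multivariate polynomials [are referred to] simply as stable polynomials"): the complex
polynomial `p` in the variables `σ` does not vanish at any point of the open upper half-space
`Hⁿ = {z : σ → ℂ | ∀ i, Im (z i) > 0}`. The zero polynomial is *not* stable in this convention
(Borcea–Brändén; Brändén 2007, §1) — some later papers (Brändén–Huh 2019, §1) add "or identically
zero"; here that disjunction is always written out (`p = 0 ∨ IsUpperHalfPlaneStable p`).
[cite: BorceaBranden2009, Introduction (definition of Ω-stable) and §1 (stable = H-stable)] -/
def IsUpperHalfPlaneStable (p : MvPolynomial σ ℂ) : Prop :=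
  ∀ z : σ → ℂ, (∀ i, 0 < (z i).im) → MvPolynomial.eval z p ≠ 0

/-- **Real stable polynomial** (Borcea–Brändén 2009, §1: "A stable polynomial with all real
coefficients is called real stable"; Brändén 2007, §3), for a polynomial with real coefficients
`p : MvPolynomial σ ℝ`: its complexification `map (algebraMap ℝ ℂ) p` is stable.
[cite: BorceaBranden2009, §1] [cite: Branden2007, §3 (before Example 3.6)] -/
def IsRealStable (p : MvPolynomial σ ℝ) : Prop :=
  IsUpperHalfPlaneStable (MvPolynomial.map (algebraMap ℝ ℂ) p)

/-- Unfolding `IsUpperHalfPlaneStable`. [folklore] -/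
theorem isUpperHalfPlaneStable_iff (p : MvPolynomial σ ℂ) :
    IsUpperHalfPlaneStable p ↔ ∀ z : σ → ℂ, (∀ i, 0 < (z i).im) → MvPolynomial.eval z p ≠ 0 :=
  Iff.rfl

/-- Unfolding `IsRealStable`: `p(z) ≠ 0` on `Hⁿ`, with `p` evaluated through `ℝ → ℂ`.
[cite: Branden2007, §3] -/
theorem isRealStable_iff (p : MvPolynomial σ ℝ) :
    IsRealStable p ↔ ∀ z : σ → ℂ, (∀ i, 0 < (z i).im) → MvPolynomial.eval₂ (algebraMap ℝ ℂ) z p ≠ 0 := by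
  simp only [IsRealStable, IsUpperHalfPlaneStable, MvPolynomial.eval_map]

/-- A stable polynomial is nonzero. [cite: BorceaBranden2009, Introduction] -/
theorem IsUpperHalfPlaneStable.ne_zero [Nonempty σ] {p : MvPolynomial σ ℂ} (hp : IsUpperHalfPlaneStable p) :
    p ≠ 0 := by
  rintro rfl
  exact hp (fun _ => Complex.I) (fun _ => by simp) (by simp)

/-- A nonzero constant is stable. [folklore] -/
theorem isUpperHalfPlaneStable_C {c : ℂ} (hc : c ≠ 0) : IsUpperHalfPlaneStable (C c : MvPolynomial σ ℂ) :=
  fun z _ => by simpa using hc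

/-- A coordinate `zᵢ` is stable. [folklore] -/
theorem isUpperHalfPlaneStable_X (i : σ) : IsUpperHalfPlaneStable (X i : MvPolynomial σ ℂ) :=
  fun z hz h => by
    rw [eval_X] at h
    simpa [h] using hz i

/-- **Products**: `p q` is stable iff `p` and `q` are (`ℂ` has no zero divisors).
[folklore] -/
theorem isUpperHalfPlaneStable_mul_iff {p q : MvPolynomial σ ℂ} :
    IsUpperHalfPlaneStable (p * q) ↔ IsUpperHalfPlaneStable p ∧ IsUpperHalfPlaneStable q := by
  simp only [IsUpperHalfPlaneStable, map_mul, mul_ne_zero_iff]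
  exact ⟨fun h => ⟨fun z hz => (h z hz).1, fun z hz => (h z hz).2⟩, fun h z hz => ⟨h.1 z hz, h.2 z hz⟩⟩

/-- Products of stable polynomials are stable. [folklore] -/
theorem IsUpperHalfPlaneStable.mul {p q : MvPolynomial σ ℂ} (hp : IsUpperHalfPlaneStable p)
    (hq : IsUpperHalfPlaneStable q) : IsUpperHalfPlaneStable (p * q) :=
  isUpperHalfPlaneStable_mul_iff.2 ⟨hp, hq⟩

/-- Finite products of stable polynomials are stable. [folklore] -/
theorem isUpperHalfPlaneStable_prod {ι : Type*} (s : Finset ι) {p : ι → MvPolynomial σ ℂ}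
    (hp : ∀ i ∈ s, IsUpperHalfPlaneStable (p i)) : IsUpperHalfPlaneStable (∏ i ∈ s, p i) := by
  intro z hz
  rw [map_prod]
  exact Finset.prod_ne_zero_iff.2 fun i hi => hp i hi z hz

/-- The square-free monomial `∏_{i ∈ S} zᵢ` is stable. [folklore] -/
theorem isUpperHalfPlaneStable_prod_X (S : Finset σ) :
    IsUpperHalfPlaneStable (∏ i ∈ S, X i : MvPolynomial σ ℂ) :=
  isUpperHalfPlaneStable_prod S fun i _ => isUpperHalfPlaneStable_X i

/-! ### Positive diagonal scaling and specialisation in the open upper half-plane -/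

/-- Evaluation of a substituted polynomial: `(bind₁ f q)(z) = q(f₁(z), …)` (Mathlib's
`eval₂Hom_bind₁`, restated for `eval`). [folklore] -/
theorem eval_bind₁ {τ : Type*} (z : τ → ℂ) (f : σ → MvPolynomial τ ℂ) (q : MvPolynomial σ ℂ) :
    eval z (bind₁ f q) = eval (fun j => eval z (f j)) q :=
  eval₂Hom_bind₁ _ _ _ _

/-- **Positive diagonal scaling preserves stability**: if `p` is stable and `cᵢ > 0` then
`p(c₁ z₁, …, cₙ zₙ)` (the substitution `zᵢ ↦ cᵢ zᵢ`, `MvPolynomial.bind₁`) is stable, since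
`z ↦ (cᵢ zᵢ)ᵢ` maps `Hⁿ` to itself (Borcea–Brändén 2009, Lemma 1.7 (2):
`f(z₁,…,λzᵢ,…,zₙ) ∈ 𝓗ₙ` for `λ > 0`). [cite: BorceaBranden2009, §1, Lemma 1.7 (2)] -/
theorem IsUpperHalfPlaneStable.diagScale {p : MvPolynomial σ ℂ} (hp : IsUpperHalfPlaneStable p)
    {c : σ → ℝ} (hc : ∀ i, 0 < c i) :
    IsUpperHalfPlaneStable (bind₁ (fun i => C ((c i : ℝ) : ℂ) * X i) p) := by
  intro z hz
  rw [eval_bind₁]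
  refine hp _ fun i => ?_
  simp only [map_mul, eval_C, eval_X, Complex.mul_im, Complex.ofReal_re, Complex.ofReal_im, zero_mul,
    add_zero]
  exact mul_pos (hc i) (hz i)

/-- **Specialising a variable in the open upper half-plane preserves stability**: if `p` is stable
and `Im ζ > 0` then `p|_{zᵢ = ζ}` (as a polynomial in the remaining variables; formally the
substitution `zᵢ ↦ ζ`, constant in `zᵢ`) is stable — immediate from the definition; the
boundary case `ζ ∈ ℝ` (Borcea–Brändén 2009, Lemma 1.7 (1), "stable or identically zero") needs
Hurwitz's theorem and is not treated here. [folklore] -/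
theorem IsUpperHalfPlaneStable.specialize [DecidableEq σ] {p : MvPolynomial σ ℂ}
    (hp : IsUpperHalfPlaneStable p) (i : σ) {ζ : ℂ} (hζ : 0 < ζ.im) :
    IsUpperHalfPlaneStable (bind₁ (Function.update X i (C ζ)) p) := by
  intro z hz
  rw [eval_bind₁]
  refine hp _ fun j => ?_
  by_cases h : j = i
  · subst h; simpa using hζ
  · simpa [Function.update_of_ne h] using hz j

/-- **Identifying two variables preserves stability** (Borcea–Brändén 2009, Lemma 1.7 (4):
`f(z₁,…,z_{i-1}, zⱼ, z_{i+1},…,zₙ) ∈ 𝓗_{n-1}`): the substitution `zᵢ ↦ zⱼ`.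
[cite: BorceaBranden2009, §1, Lemma 1.7 (4)] -/
theorem IsUpperHalfPlaneStable.identify [DecidableEq σ] {p : MvPolynomial σ ℂ}
    (hp : IsUpperHalfPlaneStable p) (i j : σ) :
    IsUpperHalfPlaneStable (bind₁ (Function.update X i (X j)) p) := by
  intro z hz
  rw [eval_bind₁]
  refine hp _ fun k => ?_
  by_cases h : k = i
  · subst h; simpa using hz j
  · simpa [Function.update_of_ne h] using hz k

/-- **Stability along positive lines** (Borcea–Brändén 2009, Lemma 1.5: "`f ∈ 𝓗ₙ(𝕂)` if and only
if `f(λt + α) ∈ 𝓗₁(𝕂)` for all `λ ∈ ℝ₊ⁿ` and `α ∈ ℝⁿ`", case `𝕂 = ℂ`): `p` is stable iff for all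
`a ∈ ℝⁿ`, `b ∈ ℝⁿ` with `bᵢ > 0`, the univariate restriction `t ↦ p(a + tb)` has no zero with
`Im t > 0` (a zero `z ∈ Hⁿ` is the point `t = i` of the line `Re z + t Im z`).
[cite: BorceaBranden2009, §1, Lemma 1.5] -/
theorem isUpperHalfPlaneStable_iff_line (p : MvPolynomial σ ℂ) :
    IsUpperHalfPlaneStable p ↔ ∀ (a b : σ → ℝ), (∀ i, 0 < b i) → ∀ t : ℂ, 0 < t.im →
      eval (fun i => (a i : ℂ) + t * b i) p ≠ 0 := by
  constructor
  · intro hp a b hb t ht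
    refine hp _ fun i => ?_
    simp only [Complex.add_im, Complex.ofReal_im, Complex.mul_im, Complex.ofReal_re, zero_add,
      mul_zero]
    exact mul_pos ht (hb i)
  · intro h z hz h0
    refine h (fun i => (z i).re) (fun i => (z i).im) hz Complex.I (by simp) ?_
    convert h0 using 3
    funext i
    apply Complex.ext <;> simp

/-! ### Multi-affine polynomials in coefficient form (the bridge to the route statements) -/

section MultiAffine

variable [Fintype σ]

/-- **Multi-affine polynomial in coefficient form**: `Σ_{S ⊆ σ} a(S) z^S` with
`z^S = ∏_{i ∈ S} zᵢ` (Borcea–Brändén 2009, §2.1: "`f` is multi-affine if it has degree at most one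
in each variable … `f(z) = Σ_{S ⊆ [n]} a(S) z^S`"; Brändén 2007, §1). [cite: BorceaBranden2009, §2.1] -/
def multiAffine {R : Type*} [CommSemiring R] (a : Finset σ → R) : MvPolynomial σ R :=
  ∑ S : Finset σ, C (a S) * ∏ i ∈ S, X i

/-- Evaluating the coefficient form: `(Σ_S a(S) z^S)(z) = Σ_S a(S) ∏_{i∈S} zᵢ`. [folklore] -/
@[simp] theorem eval_multiAffine {R : Type*} [CommSemiring R] (a : Finset σ → R) (z : σ → R) :
    eval z (multiAffine a) = ∑ S : Finset σ, a S * ∏ i ∈ S, z i := by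
  simp [multiAffine, map_sum, map_prod]

/-- Changing coefficients along a ring map. [folklore] -/
@[simp] theorem map_multiAffine {R S : Type*} [CommSemiring R] [CommSemiring S] (f : R →+* S)
    (a : Finset σ → R) : MvPolynomial.map f (multiAffine a) = multiAffine (f ∘ a) := by
  simp [multiAffine, map_sum, map_prod]

/-- **The bridge**: stability of `Σ_S a(S) z^S` is the function-form condition
"`Σ_S a(S) ∏_{i∈S} zᵢ ≠ 0` whenever all `Im zᵢ > 0`" used verbatim by the route statements
`GroundStateStability` / `StableImpliesPairCoherence` (`AtomisticToContinuum/BECPolyaSchur`).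
[cite: BorceaBranden2009, Introduction and §2.1] -/
theorem isUpperHalfPlaneStable_multiAffine_iff (a : Finset σ → ℂ) :
    IsUpperHalfPlaneStable (multiAffine a) ↔
      ∀ z : σ → ℂ, (∀ i, 0 < (z i).im) → (∑ S : Finset σ, a S * ∏ i ∈ S, z i) ≠ 0 := by
  simp only [IsUpperHalfPlaneStable, eval_multiAffine]

/-- The bridge for real coefficients (`a : Finset σ → ℝ`, cast to `ℂ` inside the sum, exactly as in
`StableImpliesPairCoherence`). [cite: Branden2007, §3] -/
theorem isRealStable_multiAffine_iff (a : Finset σ → ℝ) :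
    IsRealStable (multiAffine a) ↔
      ∀ z : σ → ℂ, (∀ i, 0 < (z i).im) → (∑ S : Finset σ, (a S : ℂ) * ∏ i ∈ S, z i) ≠ 0 := by
  rw [IsRealStable, map_multiAffine, isUpperHalfPlaneStable_multiAffine_iff]
  rfl

end MultiAffine

/-- **Multi-affine** polynomial: degree at most one in each variable (Borcea–Brändén 2009, §2.1).
[cite: BorceaBranden2009, §2.1] -/
def IsMultiAffine {R : Type*} [CommSemiring R] (p : MvPolynomial σ R) : Prop :=
  ∀ i, p.degreeOf i ≤ 1

/-- `IsMultiAffine` through the support: every exponent is `≤ 1`. [folklore] -/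
theorem isMultiAffine_iff_support {R : Type*} [CommSemiring R] (p : MvPolynomial σ R) :
    IsMultiAffine p ↔ ∀ m ∈ p.support, ∀ i, m i ≤ 1 := by
  classical
  simp only [IsMultiAffine, degreeOf_le_iff]
  exact ⟨fun h m hm i => h i m hm, fun h i m hm => h m hm i⟩

/-! ### Real stability and real-rootedness along positive lines -/

/-- For a real polynomial, complex conjugation of the point conjugates the value. [folklore] -/
theorem conj_eval₂_algebraMap (p : MvPolynomial σ ℝ) (z : σ → ℂ) :
    conj (eval₂ (algebraMap ℝ ℂ) z p) = eval₂ (algebraMap ℝ ℂ) (star z) p := by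
  rw [eval₂_comp_left (starRingEnd ℂ) (algebraMap ℝ ℂ) z p]
  congr 1
  exact RingHom.ext fun r => Complex.conj_ofReal r

/-- **Real stable ⇒ real-rooted along positive lines** (Brändén 2007, §3: "`f ∈ ℝ[z]` is real stable
if and only if for all lines `z(t) = λt + α`, `λ ∈ ℝ₊ⁿ`, `α ∈ ℝⁿ`, the polynomial `f(z(t))` has all
zeros real"): every complex zero `t` of `t ↦ p(a + t b)` (`bᵢ > 0`) is real — a zero with `Im t > 0`
would put `a + tb` in `Hⁿ`, and one with `Im t < 0` would, after conjugation (real coefficients).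
[cite: Branden2007, §3 (after Remark 3.5)] -/
theorem IsRealStable.im_eq_zero_of_eval₂_line_eq_zero {p : MvPolynomial σ ℝ} (hp : IsRealStable p)
    (a : σ → ℝ) {b : σ → ℝ} (hb : ∀ i, 0 < b i) {t : ℂ}
    (ht : eval₂ (algebraMap ℝ ℂ) (fun i => (a i : ℂ) + t * b i) p = 0) : t.im = 0 := by
  rw [isRealStable_iff] at hp
  rcases lt_trichotomy t.im 0 with h | h | h
  · refine absurd ?_ (hp (star fun i => (a i : ℂ) + t * b i) fun i => ?_)
    · rw [← conj_eval₂_algebraMap, ht, map_zero]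
    · simp only [Pi.star_apply, Complex.star_def, map_add, Complex.conj_ofReal, map_mul,
        Complex.add_im, Complex.ofReal_im, Complex.mul_im, Complex.conj_re, Complex.conj_im,
        Complex.ofReal_re, zero_add, mul_zero]
      nlinarith [hb i]
  · exact h
  · refine absurd ht (hp _ fun i => ?_)
    simp only [Complex.add_im, Complex.ofReal_im, Complex.mul_im, Complex.ofReal_re, zero_add,
      mul_zero]
    exact mul_pos h (hb i)

/-- **Real-rooted along positive lines ⇒ real stable** (the converse in Brändén 2007, §3): a zero
`z ∈ Hⁿ` is the point `t = i` of the line `Re z + t Im z`. No assumption on the coefficients is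
needed for this direction. [cite: Branden2007, §3 (after Remark 3.5)] -/
theorem isRealStable_of_line {p : MvPolynomial σ ℝ}
    (h : ∀ (a b : σ → ℝ), (∀ i, 0 < b i) → ∀ t : ℂ,
      eval₂ (algebraMap ℝ ℂ) (fun i => (a i : ℂ) + t * b i) p = 0 → t.im = 0) :
    IsRealStable p := by
  rw [isRealStable_iff]
  intro z hz h0
  have := h (fun i => (z i).re) (fun i => (z i).im) hz Complex.I (by
    convert h0 using 2
    funext i
    apply Complex.ext <;> simp)
  simp at this

/-- **The line criterion for real stability** (Brändén 2007, §3; Borcea–Brändén 2009, §1: "a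
univariate real polynomial is stable if and only if all its zeros are real" is the case `n = 1`).
[cite: Branden2007, §3 (after Remark 3.5)] -/
theorem isRealStable_iff_line (p : MvPolynomial σ ℝ) :
    IsRealStable p ↔ ∀ (a b : σ → ℝ), (∀ i, 0 < b i) → ∀ t : ℂ,
      eval₂ (algebraMap ℝ ℂ) (fun i => (a i : ℂ) + t * b i) p = 0 → t.im = 0 :=
  ⟨fun hp a _ hb _ ht => hp.im_eq_zero_of_eval₂_line_eq_zero a hb ht, isRealStable_of_line⟩

/-! ### The elementary symmetric polynomials `e₁` and `eₙ` -/

/-- `e₁ = Σᵢ zᵢ` is stable (a sum of numbers with positive imaginary part has positive imaginary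
part). [folklore] -/
theorem isUpperHalfPlaneStable_sum_X [Fintype σ] [Nonempty σ] :
    IsUpperHalfPlaneStable (∑ i, X i : MvPolynomial σ ℂ) := by
  intro z hz h
  rw [map_sum] at h
  simp only [eval_X] at h
  have : 0 < (∑ i, z i).im := by
    rw [Complex.im_sum]
    exact Finset.sum_pos (fun i _ => hz i) Finset.univ_nonempty
  rw [h] at this
  simp at this

/-- `eₙ = ∏ᵢ zᵢ` is stable. [folklore] -/
theorem isUpperHalfPlaneStable_prod_X_univ [Fintype σ] :
    IsUpperHalfPlaneStable (∏ i, X i : MvPolynomial σ ℂ) :=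
  isUpperHalfPlaneStable_prod_X Finset.univ

/-! ### Stable quadratic forms: the reverse Cauchy–Schwarz inequality (Lorentzian signature) -/

section Quadratic

variable [Fintype σ]

/-- Expanding a quadratic form along a complex line. [folklore] -/
theorem sum_sum_mul_line (K : σ → σ → ℝ) (u v : σ → ℝ) (x : ℂ) :
    (∑ i, ∑ j, (K i j : ℂ) * (x * u i + v i) * (x * u j + v j)) =
      x * x * (∑ i, ∑ j, K i j * u i * u j : ℝ) +
        x * (∑ i, ∑ j, K i j * (u i * v j + v i * u j) : ℝ) + (∑ i, ∑ j, K i j * v i * v j : ℝ) := by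
  push_cast
  simp only [Finset.mul_sum, ← Finset.sum_add_distrib]
  refine Finset.sum_congr rfl fun i _ => Finset.sum_congr rfl fun j _ => ?_
  ring

/-- **Reverse Cauchy–Schwarz for a stable quadratic form, positive direction** (Brändén–Huh 2019,
Lemma 1.5, mechanism (1) ⇔ (2) ⇔ (4): for a quadratic form `q(z) = Σᵢⱼ Kᵢⱼ zᵢ zⱼ` the univariate
polynomial `x ↦ q(xu + v)` has discriminant `B² - 4AC` with `A = q(u)`, `B = Σ Kᵢⱼ(uᵢvⱼ + vᵢuⱼ)`,
`C = q(v)`): if `q` has no zero in `Hⁿ` (real `K`) then for `u` with positive entries and real `v`,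
`4 q(u) q(v) ≤ B²` — otherwise `q(xu + v) = 0` has a root `x` with `Im x > 0`, and `xu + v ∈ Hⁿ`.
[cite: BrandenHuh2019, §1, Lemma 1.5] -/
theorem four_mul_quadratic_le_sq_of_pos (K : σ → σ → ℝ)
    (hK : ∀ z : σ → ℂ, (∀ i, 0 < (z i).im) → (∑ i, ∑ j, (K i j : ℂ) * z i * z j) ≠ 0)
    (u v : σ → ℝ) (hu : ∀ i, 0 < u i) :
    4 * (∑ i, ∑ j, K i j * u i * u j) * (∑ i, ∑ j, K i j * v i * v j) ≤
      (∑ i, ∑ j, K i j * (u i * v j + v i * u j)) ^ 2 := by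
  set A : ℝ := ∑ i, ∑ j, K i j * u i * u j with hA
  set B : ℝ := ∑ i, ∑ j, K i j * (u i * v j + v i * u j) with hB
  set Cc : ℝ := ∑ i, ∑ j, K i j * v i * v j with hC
  by_contra hlt
  push Not at hlt
  have hA0 : A ≠ 0 := by
    rintro h0
    rw [h0, mul_zero, zero_mul] at hlt
    exact absurd hlt (not_lt.2 (sq_nonneg B))
  set D : ℝ := 4 * A * Cc - B ^ 2 with hD
  have hDpos : 0 < D := by rw [hD]; linarith
  set s : ℂ := Complex.I * Real.sqrt D with hs
  have hsq : ((Real.sqrt D : ℝ) : ℂ) * (Real.sqrt D : ℂ) = (D : ℂ) := by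
    rw [← Complex.ofReal_mul, Real.mul_self_sqrt hDpos.le]
  have hss : discrim (A : ℂ) B Cc = s * s := by
    rw [discrim, hs]
    calc (B : ℂ) ^ 2 - 4 * A * Cc = -(D : ℂ) := by rw [hD]; push_cast; ring
      _ = Complex.I * Complex.I * ((Real.sqrt D : ℂ) * (Real.sqrt D : ℂ)) := by
          rw [hsq, Complex.I_mul_I]; ring
      _ = Complex.I * ↑(Real.sqrt D) * (Complex.I * ↑(Real.sqrt D)) := by ring
  have hA0' : (A : ℂ) ≠ 0 := by exact_mod_cast hA0
  have h2A : (2 * (A : ℂ)) = ((2 * A : ℝ) : ℂ) := by push_cast; ring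
  have hsD : 0 < Real.sqrt D := Real.sqrt_pos.2 hDpos
  -- a root `x` of `A x² + B x + C` with positive imaginary part
  obtain ⟨x, hx, hxim⟩ : ∃ x : ℂ, (A : ℂ) * (x * x) + B * x + Cc = 0 ∧ 0 < x.im := by
    rcases lt_or_gt_of_ne hA0 with hneg | hpos
    · refine ⟨(-(B : ℂ) - s) / (2 * A), (quadratic_eq_zero_iff hA0' hss _).2 (Or.inr rfl), ?_⟩
      rw [h2A, Complex.div_ofReal_im]
      have : (-(B : ℂ) - s).im = -Real.sqrt D := by simp [hs]
      rw [this]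
      exact div_pos_of_neg_of_neg (by linarith) (by linarith)
    · refine ⟨(-(B : ℂ) + s) / (2 * A), (quadratic_eq_zero_iff hA0' hss _).2 (Or.inl rfl), ?_⟩
      rw [h2A, Complex.div_ofReal_im]
      have : (-(B : ℂ) + s).im = Real.sqrt D := by simp [hs]
      rw [this]
      exact div_pos hsD (by linarith)
  -- the point `x u + v ∈ Hⁿ` is a zero of `q`
  refine hK (fun i => x * u i + v i) (fun i => ?_) ?_
  · simpa [Complex.add_im, Complex.mul_im] using mul_pos hxim (hu i)
  · rw [sum_sum_mul_line, ← hA, ← hB, ← hC]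
    linear_combination hx

/-- **Reverse Cauchy–Schwarz for a stable quadratic form** (the non-strict form of Brändén–Huh
2019, Lemma 1.5 (2), valid on the closure: for `u ∈ ℝⁿ` with *nonnegative* entries and any real
`v`, `4 q(u) q(v) ≤ (Σ Kᵢⱼ(uᵢvⱼ + vᵢuⱼ))²`, i.e. for symmetric `K`, `(uᵀKv)² ≥ (uᵀKu)(vᵀKv)`):
from the positive case by the limit `u + ε𝟙 → u`. This is the inequality through which the route
`BECPolyaSchur` uses "stable ⇒ Lorentzian" (Brändén–Huh, Prop. 1.2 with Lemma 1.5) for the quadratic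
forms `∂^T p`. [cite: BrandenHuh2019, §1, Lemma 1.5 (with Prop. 1.2)] -/
theorem four_mul_quadratic_le_sq (K : σ → σ → ℝ)
    (hK : ∀ z : σ → ℂ, (∀ i, 0 < (z i).im) → (∑ i, ∑ j, (K i j : ℂ) * z i * z j) ≠ 0)
    (u v : σ → ℝ) (hu : ∀ i, 0 ≤ u i) :
    4 * (∑ i, ∑ j, K i j * u i * u j) * (∑ i, ∑ j, K i j * v i * v j) ≤
      (∑ i, ∑ j, K i j * (u i * v j + v i * u j)) ^ 2 := by
  -- both sides along `u + ε𝟙`, as continuous functions of `ε`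
  let L : ℝ → ℝ := fun ε => 4 * (∑ i, ∑ j, K i j * (u i + ε) * (u j + ε)) * (∑ i, ∑ j, K i j * v i * v j)
  let R : ℝ → ℝ := fun ε => (∑ i, ∑ j, K i j * ((u i + ε) * v j + v i * (u j + ε))) ^ 2
  have hL : Continuous L := by fun_prop
  have hR : Continuous R := by fun_prop
  have hle : ∀ ε, 0 < ε → L ε ≤ R ε := fun ε hε =>
    four_mul_quadratic_le_sq_of_pos K hK (fun i => u i + ε) v fun i => by linarith [hu i]
  have hev : ∀ᶠ ε in nhdsWithin (0 : ℝ) (Set.Ioi 0), L ε ≤ R ε :=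
    eventually_nhdsWithin_of_forall fun ε hε => hle ε hε
  have hLt : Filter.Tendsto L (nhdsWithin 0 (Set.Ioi 0)) (nhds (L 0)) :=
    (hL.tendsto 0).mono_left nhdsWithin_le_nhds
  have hRt : Filter.Tendsto R (nhdsWithin 0 (Set.Ioi 0)) (nhds (R 0)) :=
    (hR.tendsto 0).mono_left nhdsWithin_le_nhds
  have key : L 0 ≤ R 0 := le_of_tendsto_of_tendsto hLt hRt hev
  simpa [L, R] using key

/-- Symmetric-matrix form of `four_mul_quadratic_le_sq`: `(uᵀKv)² ≥ (uᵀKu)(vᵀKv)` for `u ≥ 0`.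
[cite: BrandenHuh2019, §1, Lemma 1.5] -/
theorem dotProduct_mulVec_sq_ge (K : Matrix σ σ ℝ) (hKs : K.IsSymm)
    (hK : ∀ z : σ → ℂ, (∀ i, 0 < (z i).im) → (∑ i, ∑ j, (K i j : ℂ) * z i * z j) ≠ 0)
    (u v : σ → ℝ) (hu : ∀ i, 0 ≤ u i) :
    (u ⬝ᵥ K *ᵥ u) * (v ⬝ᵥ K *ᵥ v) ≤ (u ⬝ᵥ K *ᵥ v) ^ 2 := by
  have h := four_mul_quadratic_le_sq K hK u v hu
  have e1 : ∀ a b : σ → ℝ, a ⬝ᵥ K *ᵥ b = ∑ i, ∑ j, K i j * a i * b j := fun a b => by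
    simp only [dotProduct, Matrix.mulVec, Finset.mul_sum]
    exact Finset.sum_congr rfl fun i _ => Finset.sum_congr rfl fun j _ => by ring
  have e2 : (∑ i, ∑ j, K i j * (u i * v j + v i * u j)) = 2 * (u ⬝ᵥ K *ᵥ v) := by
    rw [e1, Finset.mul_sum]
    simp only [Finset.mul_sum, mul_add, Finset.sum_add_distrib]
    rw [Finset.sum_comm (f := fun i j => K i j * (v i * u j))]
    have hsym : ∀ i j, K j i = K i j := fun i j => by
      simpa [Matrix.transpose_apply] using congrFun (congrFun hKs i) j
    simp only [hsym]
    rw [← Finset.sum_add_distrib]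
    refine Finset.sum_congr rfl fun i _ => ?_
    rw [← Finset.sum_add_distrib]
    exact Finset.sum_congr rfl fun j _ => by ring
  rw [e2, e1] at h
  rw [e1, e1, e1]
  nlinarith [h]

end Quadratic

/-! ### Named facts: the Borcea–Brändén symbol criterion and Brändén's Rayleigh criterion -/

section Facts

variable [Fintype σ] [DecidableEq σ]

/-- The **(algebraic) symbol** of a linear operator `T` on polynomials in the variables `σ`,
multi-affine case `κ = (1,…,1)` (Borcea–Brändén 2009, §1.1 and Lemma 2.2):
`G_T(z, w) = T[(z + w)^{[n]}] = Σ_{S ⊆ [n]} T[z^S] w^{[n] ∖ S}`, a polynomial in the `2n` variables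
`(z, w)`, here indexed by `σ ⊕ σ` (`Sum.inl` = `z`, `Sum.inr` = `w`; `T` acts on the `z`-variables).
[cite: BorceaBranden2009, §1.1 (definition of G_T) and §2.1, Lemma 2.2] -/
def multiAffineSymbol (T : MvPolynomial σ ℂ →ₗ[ℂ] MvPolynomial σ ℂ) : MvPolynomial (σ ⊕ σ) ℂ :=
  ∑ S : Finset σ, rename Sum.inl (T (∏ i ∈ S, X i)) * ∏ i ∈ Sᶜ, X (Sum.inr i)

/-- **Borcea–Brändén 2009, Theorem 1.1, for multi-affine polynomials** (`κ = (1,…,1)`, where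
`ℂ_κ[z₁,…,zₙ]` is the space of multi-affine polynomials, §2.1). For a linear operator `T` on
complex polynomials in `n ≥ 1` variables, regarded on the multi-affine polynomials: `T` *preserves
stability* (Introduction: "for any stable `f` the polynomial `T(f)` is either stable or `T(f) ≡ 0`")
if and only if either (a) `T` has range of dimension at most one and is of the form
`T(f) = α(f) P` with `α` a linear functional and `P` a stable polynomial, or (b) the symbol
`G_T(z, w) = T[(z + w)^κ]` is stable (in `2n` variables). Stated for `T` defined on all polynomials
but constrained only on multi-affine inputs (every linear map on `ℂ_κ` extends). The route
`BECPolyaSchur` needs only the sufficiency (b) ⇒ preserver, which is Borcea–Brändén's Lemma 2.2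
(`stabilityPreserver_of_multiAffineSymbol` below). [cite: BorceaBranden2009, §1.1, Theorem 1.1 (case κ = (1,…,1)); §2.1, Lemma 2.2] -/
def BorceaBranden2009_multiAffine_stabilityPreserver_iff : Prop :=
  ∀ (σ : Type) [Fintype σ] [DecidableEq σ] [Nonempty σ]
    (T : MvPolynomial σ ℂ →ₗ[ℂ] MvPolynomial σ ℂ),
    (∀ f : MvPolynomial σ ℂ, IsMultiAffine f → IsUpperHalfPlaneStable f →
        IsUpperHalfPlaneStable (T f) ∨ T f = 0) ↔
      ((∃ (α : MvPolynomial σ ℂ →ₗ[ℂ] ℂ) (P : MvPolynomial σ ℂ), IsUpperHalfPlaneStable P ∧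
          ∀ f : MvPolynomial σ ℂ, IsMultiAffine f → T f = α f • P) ∨
        IsUpperHalfPlaneStable (multiAffineSymbol T))

omit [Fintype σ] [DecidableEq σ] in
/-- **Borcea–Brändén 2009, Lemma 2.2** (sufficiency of the symbol criterion, multi-affine case):
if `G_T(z, w) = Σ_S T[z^S] w^{[n]∖S}` is stable then `T` preserves stability — for every stable
multi-affine `f`, `T(f)` is stable or `0`. Derived here from the named fact
`BorceaBranden2009_multiAffine_stabilityPreserver_iff`. [cite: BorceaBranden2009, §2.1, Lemma 2.2] -/
theorem stabilityPreserver_of_multiAffineSymbol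
    (h : BorceaBranden2009_multiAffine_stabilityPreserver_iff) {τ : Type} [Fintype τ]
    [DecidableEq τ] [Nonempty τ] (T : MvPolynomial τ ℂ →ₗ[ℂ] MvPolynomial τ ℂ)
    (hT : IsUpperHalfPlaneStable (multiAffineSymbol T)) {f : MvPolynomial τ ℂ}
    (hf : IsMultiAffine f) (hs : IsUpperHalfPlaneStable f) :
    IsUpperHalfPlaneStable (T f) ∨ T f = 0 :=
  (h τ T).2 (Or.inr hT) f hf hs

end Facts

/-- **Rayleigh difference** `Δᵢⱼ(f) = ∂ᵢf · ∂ⱼf - ∂ᵢ∂ⱼf · f` (Brändén 2007, §5, before Thm. 5.6: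
`Δᵢⱼ(f) = ∂f/∂zᵢ · ∂f/∂zⱼ - ∂²f/∂zᵢ∂zⱼ · f`), with Mathlib's `MvPolynomial.pderiv`.
[cite: Branden2007, §5 (definition of Δ_ij before Theorem 5.6)] -/
def rayleighDiff {R : Type*} [CommRing R] (i j : σ) (f : MvPolynomial σ R) : MvPolynomial σ R :=
  pderiv i f * pderiv j f - pderiv i (pderiv j f) * f

/-- **Brändén 2007, Theorem 5.6** (the Rayleigh / "strongly Rayleigh" criterion): for a real
multi-affine polynomial `f ∈ ℝ[z₁,…,zₙ]` the following are equivalent: (1) `Δᵢⱼ(f)(x) ≥ 0` for all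
`x ∈ ℝⁿ` and all `1 ≤ i, j ≤ n`; (2) `f` is stable. Scope remark: for `f ≡ 0` condition (1) holds
trivially while the zero polynomial is not stable in the paper's convention (§1: "nonzero whenever
all the variables are in `H`"), so the equivalence is vendored for `f ≠ 0` (a weakening).
[cite: Branden2007, §5, Theorem 5.6] -/
def Branden2007_multiAffine_rayleighDiff_nonneg_iff_realStable : Prop :=
  ∀ (σ : Type) [Fintype σ] (f : MvPolynomial σ ℝ), IsMultiAffine f → f ≠ 0 →
    ((∀ (x : σ → ℝ) (i j : σ), 0 ≤ MvPolynomial.eval x (rayleighDiff i j f)) ↔ IsRealStable f)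

/-- The easy specialisation of Brändén's criterion used in practice: a nonzero real multi-affine
polynomial all of whose Rayleigh differences are pointwise nonnegative on `ℝⁿ` is real stable.
[cite: Branden2007, §5, Theorem 5.6 ((1) ⇒ (2))] -/
theorem isRealStable_of_rayleighDiff_nonneg
    (h : Branden2007_multiAffine_rayleighDiff_nonneg_iff_realStable) {τ : Type} [Fintype τ]
    {f : MvPolynomial τ ℝ} (hf : IsMultiAffine f) (hf0 : f ≠ 0)
    (hΔ : ∀ (x : τ → ℝ) (i j : τ), 0 ≤ MvPolynomial.eval x (rayleighDiff i j f)) :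
    IsRealStable f :=
  (h τ f hf hf0).1 hΔ

end Literature.Combinatorics.StablePolynomials

end
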